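import Summits.ResolutionOfSingularities.ResolutionOfSingularities.Theorems.PurelyInseparableDim4ResConeShadeTwoCorner
import HarnessLib
import HarnessLib.Audit.Tags

/-!
# Purely inseparable four-folds — K2(p), PHASE `d = 2`, PART VIII: THE SWITCH KILL on a finite CORNER window of the
# two-light-letter ledger (every prime; idea-4 «TWO-LETTER GAME» I-4-6 (C3-2L), word law, made `p`-free and finite)

[OURS · counted 0 · cell `res-dim4-pi` · seat res-dim4-p-7 g3 · K2(p) lane (holder res-dim4-p-12 lineage; desk WORDs #82 (c),
#96 (a)); hand analysis res-dim4-idea-4 (card I-4-6 (C3-2L)).]  Nothing here proves K2(p), `NoIsolatedTrap p p`, or resolution of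
singularities in dimension ≥ 4 / characteristic `p`.  AI kernel work, weaker than expert review.

The located `d = 2` residue (`…ShadeTwoResidue.shadeTwo_located`) is a two-light-letter α-tail; in idea-4's maximal-contact
frame all its moves are CORNER steps in the charts of the two light letters `u, v`.  This file proves the FINITE kernel of the
two-letter game on honest states: **`no_corner_switch_window`** — along a witnessed `Step0 p` chain of isolated shade-`2` states
off the floor with `x^r ∣ F`, on the ledger `r_u = r_v = 1`, `W = p − 1`, FIVE consecutive CORNER steps in the charts `u, v`
whose first two are `u` then `v` (a SWITCH) are impossible.  Word law (I-4-6): right after the `u`-step the `v`-witnesses of the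
child are among `v², xv, uv` (killed by the `v`-step's `x_v`-freeness), `uv²`, `uv³` (`low_witness_after_corner`, no stability
hypothesis: sources have `2a + b + c ≤ 3`); `uv² ↦ uv` blocks every further light corner, `uv³ ↦ uv² ↦ uv` or, through a
`u`-step with `u`-witness `u²v ↦ uv` / `u³v ↦ u²v ↦ uv`, blocks within two more steps.  So a frame straight to ORDER ≈ 6 at ONE
state before a switch suffices to kill the α-tail — the transfer (p-11's `FrameStep`, p-1's `TschirnhausIsolation` /
`TschirnhausJet`) and the chart-`f` (swap) presentations are NOT treated here.
bears_on: LADDER-RESOLUTION:D157-DOOR2 (res-dim4-pi · K2(p) · phase d = 2).  Supports stmt-ResolutionOfSingularities-16155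
(helper).
-/

set_option linter.dupNamespace false -- mandated namespace of this single-conjunct summit

noncomputable section

namespace Summit.ResolutionOfSingularities.ResolutionOfSingularities.Theorems.PIDim4

namespace ResCone

open MvPolynomial Finset
open Literature.AlgebraicGeometry.Resolution
open Literature.AlgebraicGeometry.Resolution.CentreBlowup
open Literature.AlgebraicGeometry.Resolution.Hauser2010
open Literature.AlgebraicGeometry.Resolution.HauserPerlega2019

variable {K : Type} [Field K] [DecidableEq K]

section Window

variable {p : ℕ} [hp : Fact p.Prime] {c : ℕ → State K} {j : ℕ → Fin 4} {b : ℕ → Fin 4 → K}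

/-! ## §1 One corner step of a chain, at a given index -/

/-- **A corner step at index `k`** (`b k = 0`): the step equation, the kept shade, the new boundary
`r_{k+1} = r_k.update (j k) (W_k + 2 − p)`, the `x_{j k}`-freeness of the quadric, no pure cube on the chart letter, and the
letters of both ends. [OURS · K2(p) phase d = 2] [folklore] -/
theorem cornerAt (hw : FreeTail.IsWitnessedChain p c j b)
    (hc : ∀ k, IsIsolated p (c k).F ∧ Step0 p (c k) (c (k + 1)) ∧ ordZero (c k).F ≠ p ∧ (c k).shade = 2)
    (hr0 : ∀ e ∈ (c 0).F.support, (c 0).r ≤ e) (k : ℕ) (hbk : b k = 0) :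
    c (k + 1) = CentreBlowup.step p Finset.univ (j k) (0 : Fin 4 → K) (c k) ∧
      (c (k + 1)).r = (c k).r.update (j k) ((c k).r.degree + 2 - p) ∧
      (∀ μ : Fin 4 →₀ ℕ, μ.degree = 2 → μ (j k) ≠ 0 → (c k).r + μ ∉ (c k).F.support) ∧
      (c k).r + Finsupp.single (j k) 3 ∉ (c k).F.support ∧
      (∀ m' : Fin 4 →₀ ℕ, (c (k + 1)).r + m' ∈ (c (k + 1)).F.support →
        ∃ m : Fin 4 →₀ ℕ, (c k).r + m ∈ (c k).F.support ∧ 2 ≤ m.degree ∧ m' = m.update (j k) (m.degree - 2)) ∧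
      (∀ m : Fin 4 →₀ ℕ, 2 ≤ m.degree → (m.update (j k) (m.degree - 2)).degree ≤ 4 → (c k).r + m ∈ (c k).F.support →
        (c (k + 1)).r + m.update (j k) (m.degree - 2) ∈ (c (k + 1)).F.support) := by
  have hp2 : 2 ≤ p := hp.out.two_le
  have hc2 : ∀ k, IsIsolated p (c k).F ∧ Step0 p (c k) (c (k + 1)) := fun k => ⟨(hc k).1, (hc k).2.1⟩
  have hr : ∀ e ∈ (c k).F.support, (c k).r ≤ e := IsolatedBand.isolated_chain_forall_le hc2 hr0 k
  have hr1 : ∀ e ∈ (c (k + 1)).F.support, (c (k + 1)).r ≤ e := IsolatedBand.isolated_chain_forall_le hc2 hr0 (k + 1)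
  obtain ⟨ho, hpW, hW2⟩ := shadeTwo_letters p hc hr0 k
  obtain ⟨-, hpW1, hW21⟩ := shadeTwo_letters p hc hr0 (k + 1)
  obtain ⟨-, -, -, -, hck⟩ := hw k
  rw [hbk] at hck
  have heq : (CentreBlowup.step p Finset.univ (j k) (0 : Fin 4 → K) (c k)).shade = (c k).shade := by
    rw [← hck, (hc (k + 1)).2.2.2, (hc k).2.2.2]
  have hiso' : IsIsolated p (CentreBlowup.step p Finset.univ (j k) (0 : Fin 4 → K) (c k)).F := by
    rw [← hck]; exact (hc (k + 1)).1
  have hr1' : ∀ e ∈ (CentreBlowup.step p Finset.univ (j k) (0 : Fin 4 → K) (c k)).F.support,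
      (CentreBlowup.step p Finset.univ (j k) (0 : Fin 4 → K) (c k)).r ≤ e := by
    rw [← hck]; exact hr1
  refine ⟨hck, ?_, fun μ hμ hμj => not_mem_support_add_of_apply_ne_zero (p := p) (j k) rfl ho hr hpW hW2 heq hμ hμj,
    not_mem_support_add_three_single hp2 (j k) rfl ho hr hpW hW2 heq hiso' hr1', fun m' hm' => ?_,
    fun m hm2 hm4 hm => ?_⟩
  · rw [hck, shadeTwo_step_r (j k) rfl (c k) ho hr]
    congr 1
    ext i
    rw [Finsupp.filter_apply, if_pos (Pi.zero_apply _)]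
  · rw [hck] at hm'
    exact exists_source_of_corner (j k) (c k) rfl ho hr (by omega) hm'
  · have hW1 : p ≤ (CentreBlowup.step p Finset.univ (j k) (0 : Fin 4 → K) (c k)).r.degree + 1 := by
      rw [← hck]; exact hpW1
    have hW21' : (CentreBlowup.step p Finset.univ (j k) (0 : Fin 4 → K) (c k)).r.degree + 4 ≤ 2 * p := by
      rw [← hck]; exact hW21
    have hnp := not_isPthPowerExponent_add_of_shadeTwo hp2 hiso' hr1' rfl hW1 hW21' hm4
    rw [hck, MvPolynomial.mem_support_iff, coeff_corner_of_not_isPthPowerExponent (j k) (c k) rfl ho hr (by omega) hm2 hnp]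
    exact MvPolynomial.mem_support_iff.mp hm

/-! ## §2 Low witnesses right after a corner step -/

/-- **LOW WITNESSES RIGHT AFTER A CORNER STEP** (no stability hypothesis): after a corner step in chart `c' = j k`, a
monomial `x^{r_{k+1} + m′}` of `F_{k+1}` with `|m′| ≤ m′_a + 1` for a letter `a ≠ c'` is either a QUADRIC monomial
involving `x_a`, or `x^{r + 2e_a + e_{c'}}` (sourced by itself), or `x^{r + 3e_a + e_{c'}}` (sourced by the pure cube
`x^{r + 3e_a}`).  (Sources have `2a + b + c ≤ 3`; `x_{c'}², x_{c'}x_a, x_{c'}³` are excluded at the parent.)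
[OURS · K2(p) phase d = 2] [folklore] -/
theorem low_witness_after_corner (hw : FreeTail.IsWitnessedChain p c j b)
    (hc : ∀ k, IsIsolated p (c k).F ∧ Step0 p (c k) (c (k + 1)) ∧ ordZero (c k).F ≠ p ∧ (c k).shade = 2)
    (hr0 : ∀ e ∈ (c 0).F.support, (c 0).r ≤ e) (k : ℕ) (hbk : b k = 0) {a : Fin 4} (ha : a ≠ j k)
    {m' : Fin 4 →₀ ℕ} (hm' : (c (k + 1)).r + m' ∈ (c (k + 1)).F.support) (hlow : m'.degree ≤ m' a + 1) :
    (m'.degree = 2 ∧ 1 ≤ m' a) ∨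
      (m' = Finsupp.single a 2 + Finsupp.single (j k) 1 ∧
        (c k).r + (Finsupp.single a 2 + Finsupp.single (j k) 1) ∈ (c k).F.support) ∨
      (m' = Finsupp.single a 3 + Finsupp.single (j k) 1 ∧ (c k).r + Finsupp.single a 3 ∈ (c k).F.support) := by
  obtain ⟨-, -, hfree, hcube, hsrc, -⟩ := cornerAt hw hc hr0 k hbk
  obtain ⟨m, hm, hm2, hupd⟩ := hsrc m' hm'
  obtain ⟨hmj, hmi⟩ := apply_of_eq_update hupd
  have hma : m' a = m a := hmi a ha
  have hdeg' := degree_update_add m (j k) (m.degree - 2)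
  rw [← hupd] at hdeg'
  have hle2 := apply_add_apply_le_degree m ha
  rcases Nat.lt_or_ge m.degree 3 with hlt3 | hge3
  · -- `|m| = 2`: the child monomial is the parent one, a quadric monomial involving `x_a`
    have hdeg2 : m.degree = 2 := by omega
    have hmj0 : m (j k) = 0 := by
      by_contra hne
      exact hfree m hdeg2 hne hm
    left
    constructor <;> omega
  · have hdeg3 : m.degree = 3 := by omega
    have hsum : m.degree = m a + m (j k) := by omega
    have hrest := apply_eq_zero_of_degree_eq m ha hsum
    have hmeq := eq_single_add_single_of_forall m ha hrest
    rcases (show m a = 0 ∨ m a = 1 ∨ m a = 2 ∨ m a = 3 by omega) with h0 | h1 | h2 | h3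
    · exfalso
      have hjk : m (j k) = 3 := by omega
      rw [h0, hjk, Finsupp.single_zero, zero_add] at hmeq
      exact hcube (hmeq ▸ hm)
    · -- `x_{c'}² x_a ↦ x_{c'} x_a`: a quadric monomial involving `x_a`
      left
      constructor <;> omega
    · right; left
      have hjk : m (j k) = 1 := by omega
      rw [h2, hjk] at hmeq
      refine ⟨?_, hmeq ▸ hm⟩
      ext i
      by_cases hi : i = j k
      · rw [hi, hmj, hdeg3, Finsupp.add_apply, Finsupp.single_apply, if_neg ha, Finsupp.single_eq_same]
      · rw [hmi i hi, hmeq]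
    · right; right
      have hjk : m (j k) = 0 := by omega
      rw [h3, hjk, Finsupp.single_zero, add_zero] at hmeq
      refine ⟨?_, hmeq ▸ hm⟩
      ext i
      by_cases hi : i = j k
      · rw [hi, hmj, hdeg3, Finsupp.add_apply, Finsupp.single_apply, if_neg ha, Finsupp.single_eq_same]
      · rw [hmi i hi, hmeq, Finsupp.add_apply, Finsupp.single_apply (a := j k), if_neg (fun h => hi h.symm), add_zero]

/-- **An axis witness for a light letter**: on the ledger `W = p − 1`, `r_a = 1`, isolation of `c k` gives a monomial
`x^{r_k + m}` with `|m| ≤ m_a + 1`. [OURS · K2(p) phase d = 2] [folklore] -/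
theorem exists_light_witness
    (hc : ∀ k, IsIsolated p (c k).F ∧ Step0 p (c k) (c (k + 1)) ∧ ordZero (c k).F ≠ p ∧ (c k).shade = 2)
    (hr0 : ∀ e ∈ (c 0).F.support, (c 0).r ≤ e) (k : ℕ) (hW : (c k).r.degree + 1 = p) {a : Fin 4}
    (ha : (c k).r a = 1) : ∃ m : Fin 4 →₀ ℕ, (c k).r + m ∈ (c k).F.support ∧ m.degree ≤ m a + 1 := by
  obtain ⟨m, hm, -, hlt⟩ := exists_axis_witness hc hr0 k a
  exact ⟨m, hm, by omega⟩

/-! ## §3 The switch kill -/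

omit [DecidableEq K] in
/-- Updating the second letter of a two-letter exponent. [folklore] -/
theorem update_single_add_single_right {a e : Fin 4} (hae : a ≠ e) (x y z : ℕ) :
    (Finsupp.single a x + Finsupp.single e y : Fin 4 →₀ ℕ).update e z = Finsupp.single a x + Finsupp.single e z := by
  ext i
  rw [Finsupp.update_apply]
  simp only [Finsupp.add_apply, Finsupp.single_apply]
  split_ifs <;> omega

omit [DecidableEq K] in
/-- Updating the first letter of a two-letter exponent. [folklore] -/
theorem update_single_add_single_left {a e : Fin 4} (hae : a ≠ e) (x y z : ℕ) :
    (Finsupp.single a x + Finsupp.single e y : Fin 4 →₀ ℕ).update a z = Finsupp.single a z + Finsupp.single e y := by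
  ext i
  rw [Finsupp.update_apply]
  simp only [Finsupp.add_apply, Finsupp.single_apply]
  split_ifs <;> omega

omit [DecidableEq K] in
/-- Degree of a two-letter exponent. [folklore] -/
theorem degree_single_add_single (a e : Fin 4) (x y : ℕ) :
    (Finsupp.single a x + Finsupp.single e y : Fin 4 →₀ ℕ).degree = x + y := by
  rw [map_add, Finsupp.degree_single, Finsupp.degree_single]

/-- **Forward transport of an explicit monomial** through the corner step at index `k`. [OURS · K2(p) phase d = 2]
[folklore] -/
theorem cornerAt_image (hw : FreeTail.IsWitnessedChain p c j b)
    (hc : ∀ k, IsIsolated p (c k).F ∧ Step0 p (c k) (c (k + 1)) ∧ ordZero (c k).F ≠ p ∧ (c k).shade = 2)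
    (hr0 : ∀ e ∈ (c 0).F.support, (c 0).r ≤ e) (k : ℕ) (hbk : b k = 0) {m m' : Fin 4 →₀ ℕ}
    (hupd : m.update (j k) (m.degree - 2) = m') (hm2 : 2 ≤ m.degree) (hm'4 : m'.degree ≤ 4)
    (hm : (c k).r + m ∈ (c k).F.support) : (c (k + 1)).r + m' ∈ (c (k + 1)).F.support := by
  obtain ⟨-, -, -, -, -, himg⟩ := cornerAt hw hc hr0 k hbk
  rw [← hupd]
  exact himg m hm2 (by rw [hupd]; exact hm'4) hm

/-- A quadric monomial `x_u x_v` blocks every further corner step in the charts `u, v`. [folklore] -/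
theorem not_corner_of_mixed (hw : FreeTail.IsWitnessedChain p c j b)
    (hc : ∀ k, IsIsolated p (c k).F ∧ Step0 p (c k) (c (k + 1)) ∧ ordZero (c k).F ≠ p ∧ (c k).shade = 2)
    (hr0 : ∀ e ∈ (c 0).F.support, (c 0).r ≤ e) (k : ℕ) (hbk : b k = 0) {u v : Fin 4} (huv : u ≠ v)
    (hjk : j k = u ∨ j k = v)
    (hmem : (c k).r + (Finsupp.single u 1 + Finsupp.single v 1) ∈ (c k).F.support) : False := by
  obtain ⟨-, -, hfree, -, -, -⟩ := cornerAt hw hc hr0 k hbk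
  refine hfree _ (degree_single_add_single u v 1 1) ?_ hmem
  rcases hjk with h | h <;> rw [h, Finsupp.add_apply, Finsupp.single_apply, Finsupp.single_apply]
  · rw [if_pos rfl]; omega
  · rw [if_neg huv, if_pos rfl]; omega

/-- **The descent `a b² → a b` and `a² b → a b`**: a cubic two-letter monomial over the boundary at a corner step in the
chart of its squared letter breeds the mixed quadric monomial, which blocks the next light corner. [OURS · K2(p) phase
d = 2] [folklore] -/
theorem mixed_of_sq_mul (hw : FreeTail.IsWitnessedChain p c j b)
    (hc : ∀ k, IsIsolated p (c k).F ∧ Step0 p (c k) (c (k + 1)) ∧ ordZero (c k).F ≠ p ∧ (c k).shade = 2)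
    (hr0 : ∀ e ∈ (c 0).F.support, (c 0).r ≤ e) (k : ℕ) (hbk : b k = 0) {a e : Fin 4} (hae : a ≠ e) (hjk : j k = e)
    (hmem : (c k).r + (Finsupp.single a 1 + Finsupp.single e 2) ∈ (c k).F.support) :
    (c (k + 1)).r + (Finsupp.single a 1 + Finsupp.single e 1) ∈ (c (k + 1)).F.support :=
  cornerAt_image hw hc hr0 k hbk (by rw [hjk, degree_single_add_single, update_single_add_single_right hae])
    (by rw [degree_single_add_single]; omega) (by rw [degree_single_add_single]; omega) hmem

/-- **The descent `a b³ → a b²`**. [OURS · K2(p) phase d = 2] [folklore] -/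
theorem sq_mul_of_cube_mul (hw : FreeTail.IsWitnessedChain p c j b)
    (hc : ∀ k, IsIsolated p (c k).F ∧ Step0 p (c k) (c (k + 1)) ∧ ordZero (c k).F ≠ p ∧ (c k).shade = 2)
    (hr0 : ∀ e ∈ (c 0).F.support, (c 0).r ≤ e) (k : ℕ) (hbk : b k = 0) {a e : Fin 4} (hae : a ≠ e) (hjk : j k = e)
    (hmem : (c k).r + (Finsupp.single a 1 + Finsupp.single e 3) ∈ (c k).F.support) :
    (c (k + 1)).r + (Finsupp.single a 1 + Finsupp.single e 2) ∈ (c (k + 1)).F.support :=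
  cornerAt_image hw hc hr0 k hbk (by rw [hjk, degree_single_add_single, update_single_add_single_right hae])
    (by rw [degree_single_add_single]; omega) (by rw [degree_single_add_single]; omega) hmem

/-- **Persistence `a b² → a b²` under the corner step in the chart of the LINEAR letter `a`**. [OURS · K2(p) phase d = 2]
[folklore] -/
theorem sq_mul_persist (hw : FreeTail.IsWitnessedChain p c j b)
    (hc : ∀ k, IsIsolated p (c k).F ∧ Step0 p (c k) (c (k + 1)) ∧ ordZero (c k).F ≠ p ∧ (c k).shade = 2)
    (hr0 : ∀ e ∈ (c 0).F.support, (c 0).r ≤ e) (k : ℕ) (hbk : b k = 0) {a e : Fin 4} (hae : a ≠ e) (hjk : j k = a)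
    (hmem : (c k).r + (Finsupp.single a 1 + Finsupp.single e 2) ∈ (c k).F.support) :
    (c (k + 1)).r + (Finsupp.single a 1 + Finsupp.single e 2) ∈ (c (k + 1)).F.support :=
  cornerAt_image hw hc hr0 k hbk (by rw [hjk, degree_single_add_single, update_single_add_single_left hae])
    (by rw [degree_single_add_single]; omega) (by rw [degree_single_add_single]; omega) hmem

/-- **After a switch, two more light corners in the charts `u, v` are impossible when `x^{r + u v²}` is present**
(`v`: `uv² ↦ uv`; `u`: the `u`-witness is `u²v ↦ uv` or `u³v ↦ u²v`, then `u²v ↦ uv` / `uv² ↦ uv`). [OURS · K2(p) phase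
d = 2] [folklore] -/
theorem no_two_corners_after_sq_mul (hw : FreeTail.IsWitnessedChain p c j b)
    (hc : ∀ k, IsIsolated p (c k).F ∧ Step0 p (c k) (c (k + 1)) ∧ ordZero (c k).F ≠ p ∧ (c k).shade = 2)
    (hr0 : ∀ e ∈ (c 0).F.support, (c 0).r ≤ e) (t : ℕ) {u v : Fin 4} (huv : u ≠ v) (hjv : j t = v) (hbt : b t = 0)
    (hW : (c (t + 1)).r.degree + 1 = p) (hru : (c (t + 1)).r u = 1)
    (hb1 : b (t + 1) = 0) (hb2 : b (t + 2) = 0) (hb3 : b (t + 3) = 0)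
    (hj1 : j (t + 1) = u ∨ j (t + 1) = v) (hj2 : j (t + 2) = u ∨ j (t + 2) = v) (hj3 : j (t + 3) = u ∨ j (t + 3) = v)
    (hmem : (c (t + 1)).r + (Finsupp.single u 1 + Finsupp.single v 2) ∈ (c (t + 1)).F.support) : False := by
  rcases hj1 with hj1 | hj1
  · -- step `t+1` in chart `u`: read the `u`-witness of `c (t+1)` (child of the `v`-step `t`)
    obtain ⟨m₂, hm₂, hlow₂⟩ := exists_light_witness hc hr0 (t + 1) hW hru
    have huj : u ≠ j t := by rw [hjv]; exact huv
    obtain ⟨-, -, hfree2, -, -, -⟩ := cornerAt hw hc hr0 (t + 1) hb1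
    rcases low_witness_after_corner hw hc hr0 t hbt huj hm₂ hlow₂ with ⟨hdeg2, hu1⟩ | ⟨hm₂eq, -⟩ | ⟨hm₂eq, -⟩
    · exact hfree2 m₂ hdeg2 (by rw [hj1]; omega) hm₂
    · -- `u²v ↦ uv` blocks step `t+2`
      rw [hjv, add_comm] at hm₂eq
      rw [hm₂eq] at hm₂
      exact not_corner_of_mixed hw hc hr0 (t + 2) hb2 huv.symm (Or.symm hj2)
        (mixed_of_sq_mul hw hc hr0 (t + 1) hb1 huv.symm hj1 hm₂)
    · -- `u³v ↦ u²v`, `uv² ↦ uv²`; then step `t+2` breeds `uv`, blocking step `t+3`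
      rw [hjv, add_comm] at hm₂eq
      rw [hm₂eq] at hm₂
      have h3a := sq_mul_of_cube_mul hw hc hr0 (t + 1) hb1 huv.symm hj1 hm₂
      have h3b := sq_mul_persist hw hc hr0 (t + 1) hb1 huv hj1 hmem
      rcases hj2 with hj2 | hj2
      · exact not_corner_of_mixed hw hc hr0 (t + 3) hb3 huv.symm (Or.symm hj3)
          (mixed_of_sq_mul hw hc hr0 (t + 2) hb2 huv.symm hj2 h3a)
      · exact not_corner_of_mixed hw hc hr0 (t + 3) hb3 huv hj3 (mixed_of_sq_mul hw hc hr0 (t + 2) hb2 huv hj2 h3b)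
  · -- step `t+1` in chart `v`: `uv² ↦ uv` blocks step `t+2`
    exact not_corner_of_mixed hw hc hr0 (t + 2) hb2 huv hj2 (mixed_of_sq_mul hw hc hr0 (t + 1) hb1 huv hj1 hmem)

/-- **THE SWITCH KILL ON A CORNER WINDOW** (idea-4 I-4-6 (C3-2L) word law, finite and `p`-free): along a witnessed `Step0 p`
chain of isolated shade-`2` states off the floor with `x^{r₀} ∣ F₀`, suppose the states `t+1, t+2` have `W = p − 1` with `v`
light at `t+1` and `u` light at `t+2` (`u ≠ v`), and the five steps `t, …, t+4` are CORNER steps (`b = 0`) in the charts `u, v`, the first in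
`u`, the second in `v`.  Contradiction: the switch `u → v` leaves `v`-witnesses `uv²` or `uv³` only, and the mixed quadric
monomial `uv` they breed within three steps blocks the light corners. [OURS · K2(p) phase d = 2] [folklore] -/
theorem no_corner_switch_window (hw : FreeTail.IsWitnessedChain p c j b)
    (hc : ∀ k, IsIsolated p (c k).F ∧ Step0 p (c k) (c (k + 1)) ∧ ordZero (c k).F ≠ p ∧ (c k).shade = 2)
    (hr0 : ∀ e ∈ (c 0).F.support, (c 0).r ≤ e) (t : ℕ) {u v : Fin 4} (huv : u ≠ v)
    (hW1 : (c (t + 1)).r.degree + 1 = p) (hW2 : (c (t + 2)).r.degree + 1 = p)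
    (hrv1 : (c (t + 1)).r v = 1) (hru2 : (c (t + 2)).r u = 1)
    (hb0 : b t = 0) (hb1 : b (t + 1) = 0) (hb2 : b (t + 2) = 0) (hb3 : b (t + 3) = 0) (hb4 : b (t + 4) = 0)
    (hju : j t = u) (hjv : j (t + 1) = v) (hj2 : j (t + 2) = u ∨ j (t + 2) = v)
    (hj3 : j (t + 3) = u ∨ j (t + 3) = v) (hj4 : j (t + 4) = u ∨ j (t + 4) = v) : False := by
  -- the `v`-witness of `c (t+1)` right after the `u`-step
  obtain ⟨m₁, hm₁, hlow₁⟩ := exists_light_witness hc hr0 (t + 1) hW1 hrv1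
  have hvj : v ≠ j t := by rw [hju]; exact huv.symm
  obtain ⟨-, -, hfree1, -, -, -⟩ := cornerAt hw hc hr0 (t + 1) hb1
  rcases low_witness_after_corner hw hc hr0 t hb0 hvj hm₁ hlow₁ with ⟨hdeg2, hv1⟩ | ⟨hm₁eq, -⟩ | ⟨hm₁eq, -⟩
  · -- a quadric monomial involving `x_v` at a `v`-step: excluded
    exact hfree1 m₁ hdeg2 (by rw [hjv]; omega) hm₁
  · -- `uv²` at `t+1` ↦ `uv` at `t+2`: blocks step `t+2`
    rw [hju, add_comm] at hm₁eq
    rw [hm₁eq] at hm₁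
    exact not_corner_of_mixed hw hc hr0 (t + 2) hb2 huv hj2 (mixed_of_sq_mul hw hc hr0 (t + 1) hb1 huv hjv hm₁)
  · -- `uv³` at `t+1` ↦ `uv²` at `t+2`, then `no_two_corners_after_sq_mul`
    rw [hju, add_comm] at hm₁eq
    rw [hm₁eq] at hm₁
    exact no_two_corners_after_sq_mul hw hc hr0 (t + 1) huv hjv hb1 hW2 hru2 hb2 hb3 hb4 hj2 hj3 hj4
      (sq_mul_of_cube_mul hw hc hr0 (t + 1) hb1 huv hjv hm₁)

end Window

end ResCone

end Summit.ResolutionOfSingularities.ResolutionOfSingularities.Theorems.PIDim4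

end
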